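import Mathlib
import HarnessLib
import Summits.NavierStokesRegularity.NavierStokesRegularity.Theorems.UnthreadedRigidityDoorUnthreadedRigidityMixedPairWindowBalance
import Summits.NavierStokesRegularity.NavierStokesRegularity.Theorems.UnthreadedRigidityDoorUnthreadedRigidityMixedPairSphereTools
import Summits.NavierStokesRegularity.NavierStokesRegularity.Theorems.UnthreadedRigidityDoorUnthreadedRigidityVirialHornAngularJets
import Summits.NavierStokesRegularity.NavierStokesRegularity.Theorems.UnthreadedRigidityDoorUnthreadedRigidityCoZonalDefs

/-!
# Route `UnthreadedRigidityDoor`, item `UnthreadedRigidity` (W2, stmt-NavierStokesRegularity-27585) — LINE g12-1 «CO-ZONAL» / g12-2 «PERSISTENCE»: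
# TWO-SHELL WINDOWS OF OPPOSITE PARITY ARE TOROIDALLY BALANCED WITH RADIAL COEFFICIENTS (bridge M for two shells of degrees odd/even)

Prover file (engine-1 g73; `--supports stmt-NavierStokesRegularity-27585 --as helper`; route-independent imports).

The first brick of the persistence road for the NEXT degree pairs (HOME engine/engine-1/HANDOFF-engine1-g73.md §1b): the pair version
`MixedPair.pair_window_toroidal_balance` (file `…MixedPairWindowBalance`, degrees (1,2)) VERBATIM for two-shells
`u(t) = twoShellL (H₁ t) (H₂ t) Y₁ Y₂ x₀` over FIXED solid harmonics `Y₁`, `Y₂` of degrees `l₁` ODD and `l₂` EVEN (any such pair):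

  `curl(ω × u)(x₀ + y) = e₁(|y|) ∇Y₁(y) × y + e₂(|y|) ∇Y₂(y) × y`   with RADIAL `e₁, e₂`   (`twoShell_window_toroidal_balance`).

Ingredients: `Persistence.window_lambCurl_eq` (`∂ₜω + curl(ω×u) = Δω`), `Δω` toroidal over the two shells (three curls of the shells with
profiles `−cᵢ`), and the PARITY READ-OFF of the time derivative: a solid harmonic of degree `l` satisfies `Y(−y) = (−1)^l Y(y)`
(`IsSolidHarmonic.apply_smul`, `solidHarmonic_apply_neg`), so its carrier `∇Y(y) × y` is odd/even with `l` (`carrier_neg_of_odd` / `carrier_neg_of_even`), and `c₁(·,|y|²)`,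
`c₂(·,|y|²)` are read off `ω(·,x₀ ± y)` separately (`window_differentiable_time_curl`).  The (even, odd) case is the same statement with the
shells swapped (`twoShellL H₁ H₂ Y₁ Y₂ = twoShellL H₂ H₁ Y₂ Y₁`).

HONEST LABEL: bookkeeping about SPECIAL two-shell data inside a HYPOTHETICAL bounded mild window (support of a rung line); nothing here bears on
`UnthreadedRigidity` (27585), the door Target, W2 or Navier–Stokes regularity; no summit statement is proved.  MODEL/rung work; 0 kit.
-/


noncomputable section

-- the summit and its single sub-problem share the name (CONVENTIONS §1), as in every Theorems file
set_option linter.dupNamespace false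

namespace Summit.NavierStokesRegularity.NavierStokesRegularity.Theorems.UnthreadedRigidity.MixedPair

open Set Function Filter Topology
open scoped RealInnerProductSpace Laplacian ContDiff
open Literature.Analysis Literature.Analysis.FluidPDE
open Literature.Analysis.UnboundedOperators (heatExtension)
open Summit.NavierStokesRegularity.NavierStokesRegularity.Theorems.UnthreadedRigidity.ProfileHorn (E3)
open Summit.NavierStokesRegularity.NavierStokesRegularity.Theorems.UnthreadedRigidity.VirialHorn
  (IsSolidHarmonic VirialAdmissible sepShellL exists_curl_curl_curl_shell sepShellL_eq_comp_sub laplacian_comp_sub_const curl_shell_eq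
    curl_comp_sub_const_fun contDiff_shell contDiff_top_sepShellL)
open Summit.NavierStokesRegularity.NavierStokesRegularity.Theorems.UnthreadedRigidity.Persistence (window_lambCurl_eq
  window_differentiable_time_curl)
open Summit.NavierStokesRegularity.NavierStokesRegularity.Theorems.UnthreadedRigidity.CoZonal (twoShellL)

variable {S : Set ℝ} {u : ℝ → E3 → E3} {x₀ : E3}

/-! ## Parity of solid harmonics and their toroidal carriers -/

section HarmonicParity

variable {l : ℕ} {Y : E3 → ℝ}

/-- `Y(−y) = (−1)^l Y(y)` for a solid harmonic of degree `l`. [folklore] -/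
theorem solidHarmonic_apply_neg (hY : IsSolidHarmonic l Y) (y : E3) : Y (-y) = (-1) ^ l * Y y := by
  rw [show -y = (-1 : ℝ) • y by simp, hY.apply_smul]

/-- an ODD-degree solid harmonic is odd, with EVEN gradient. [folklore] -/
theorem solidHarmonic_gradient_neg_of_odd (hY : IsSolidHarmonic l Y) (hl : Odd l) (y : E3) : gradient Y (-y) = gradient Y y := by
  have hodd : ∀ z : E3, Y (-z) = -Y z := fun z => by rw [solidHarmonic_apply_neg hY, hl.neg_one_pow]; ring
  have hYd : Differentiable ℝ Y := hY.contDiff.differentiable (by simp)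
  have hfun : (fun x : E3 => Y (-x)) = fun x => -Y x := funext hodd
  have h1 : HasFDerivAt (fun x : E3 => -x) (-(ContinuousLinearMap.id ℝ E3)) y := (hasFDerivAt_id y).neg
  have h2 : HasFDerivAt (fun x : E3 => Y (-x)) ((fderiv ℝ Y (-y)).comp (-(ContinuousLinearMap.id ℝ E3))) y :=
    (hYd (-y)).hasFDerivAt.comp y h1
  rw [hfun] at h2
  have h3 : fderiv ℝ (fun x => -Y x) y = -fderiv ℝ Y y := fderiv_fun_neg
  have h4 := h2.fderiv
  rw [h3] at h4
  have h5 : fderiv ℝ Y y = fderiv ℝ Y (-y) := by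
    have : (fderiv ℝ Y (-y)).comp (-(ContinuousLinearMap.id ℝ E3)) = -fderiv ℝ Y (-y) := by ext v; simp
    rw [this] at h4
    exact neg_inj.1 h4
  rw [gradient, gradient, h5]

/-- an EVEN-degree solid harmonic is even, with ODD gradient. [folklore] -/
theorem solidHarmonic_gradient_neg_of_even (hY : IsSolidHarmonic l Y) (hl : Even l) (y : E3) : gradient Y (-y) = -gradient Y y := by
  have heven : ∀ z : E3, Y (-z) = Y z := fun z => by rw [solidHarmonic_apply_neg hY, hl.neg_one_pow, one_mul]
  exact gradient_at_neg_of_even heven ((hY.contDiff.differentiable (by simp)) y)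

/-- the toroidal carrier of an ODD-degree harmonic is ODD. [folklore] -/
theorem carrier_neg_of_odd (hY : IsSolidHarmonic l Y) (hl : Odd l) (y : E3) :
    cross (gradient Y (-y)) (-y) = -cross (gradient Y y) y := by
  rw [solidHarmonic_gradient_neg_of_odd hY hl, ← crossCLM_apply (gradient Y y) (-y), ← crossCLM_apply (gradient Y y) y, map_neg]

/-- the toroidal carrier of an EVEN-degree harmonic is EVEN. [folklore] -/
theorem carrier_neg_of_even (hY : IsSolidHarmonic l Y) (hl : Even l) (y : E3) :
    cross (gradient Y (-y)) (-y) = cross (gradient Y y) y := by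
  rw [solidHarmonic_gradient_neg_of_even hY hl, cross_neg_neg]

end HarmonicParity

/-! ## Toroidal balance of two-shell slices of opposite parity -/

/-- ★ **TWO-SHELL SLICES OF OPPOSITE PARITY IN A BOUNDED MILD WINDOW ARE TOROIDALLY BALANCED, WITH RADIAL COEFFICIENTS**:
`curl(ω × u)(x₀ + y) = e₁(|y|) ∇Y₁(y) × y + e₂(|y|) ∇Y₂(y) × y` for `l₁` odd, `l₂` even (module docstring). -/
theorem twoShell_window_toroidal_balance (hS : IsOpen S) (hcont : ContinuousOn (uncurry u) (S ×ˢ univ))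
    (hdiv : ∀ t ∈ S, VectorCalculus.IsDivFree (u t))
    (hmild : ∀ s ∈ S, ∀ t ∈ S, s < t → ∀ x, u t x = heatExtension (u s) (t - s) x - oseenDuhamel 1 s u u t x)
    (hbdd : ∀ τ ∈ S, ∃ B : ℝ, ∀ t ∈ S, t ≤ τ → ∀ x, ‖u t x‖ ≤ B)
    {l₁ l₂ : ℕ} (hl₁ : Odd l₁) (hl₂ : Even l₂) {Y₁ Y₂ : E3 → ℝ} (hY₁ : IsSolidHarmonic l₁ Y₁) (hY₂ : IsSolidHarmonic l₂ Y₂)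
    {H₁f H₂f : ℝ → ℝ → ℝ} (hadm₁ : ∀ t ∈ S, VirialAdmissible l₁ (H₁f t)) (hadm₂ : ∀ t ∈ S, VirialAdmissible l₂ (H₂f t))
    (hshape : ∀ t ∈ S, u t = twoShellL (H₁f t) (H₂f t) Y₁ Y₂ x₀) {t : ℝ} (ht : t ∈ S) :
    ∃ e₁ e₂ : ℝ → ℝ, ∀ y : E3,
      curl (fun x => cross (curl (u t) x) (u t x)) (x₀ + y) =
        e₁ ‖y‖ • cross (gradient Y₁ y) y + e₂ ‖y‖ • cross (gradient Y₂ y) y := by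
  -- names for the carriers
  set W₁ : E3 → E3 := fun y => cross (gradient Y₁ y) y with hW₁
  set W₂ : E3 → E3 := fun y => cross (gradient Y₂ y) y with hW₂
  have hW₁neg : ∀ y : E3, W₁ (-y) = -W₁ y := fun y => carrier_neg_of_odd hY₁ hl₁ y
  have hW₂neg : ∀ y : E3, W₂ (-y) = W₂ y := fun y => carrier_neg_of_even hY₂ hl₂ y
  -- smooth even representatives of the profiles and the toroidal vorticity coefficients of both shells
  have hrep₁ : ∀ s ∈ S, ∃ h : ℝ → ℝ, ContDiff ℝ (⊤ : ℕ∞) h ∧ ∀ r : ℝ, 0 ≤ r → H₁f s r = h (r ^ 2) :=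
    fun s hs => (hadm₁ s hs).1
  have hrep₂ : ∀ s ∈ S, ∃ h : ℝ → ℝ, ContDiff ℝ (⊤ : ℕ∞) h ∧ ∀ r : ℝ, 0 ≤ r → H₂f s r = h (r ^ 2) :=
    fun s hs => (hadm₂ s hs).1
  choose! h₁ hh₁ hHh₁ using hrep₁
  choose! h₂ hh₂ hHh₂ using hrep₂
  have hc₁ : ∀ s ∈ S, ∃ c : ℝ → ℝ, ContDiff ℝ (⊤ : ℕ∞) c ∧
      curl (curl (curl (fun z : E3 => (h₁ s (‖z‖ ^ 2) * Y₁ z) • z))) = fun y : E3 => -(c (‖y‖ ^ 2) • W₁ y) :=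
    fun s hs => exists_curl_curl_curl_shell (hh₁ s hs) hY₁
  have hc₂ : ∀ s ∈ S, ∃ c : ℝ → ℝ, ContDiff ℝ (⊤ : ℕ∞) c ∧
      curl (curl (curl (fun z : E3 => (h₂ s (‖z‖ ^ 2) * Y₂ z) • z))) = fun y : E3 => -(c (‖y‖ ^ 2) • W₂ y) :=
    fun s hs => exists_curl_curl_curl_shell (hh₂ s hs) hY₂
  choose! c₁ hcc₁ hcurl₁ using hc₁
  choose! c₂ hcc₂ hcurl₂ using hc₂
  -- the vorticity of the slices: `ω(s, x₀ + y) = −c₁ W₁ − c₂ W₂`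
  have hdiff₁ : ∀ s ∈ S, ∀ x : E3, DifferentiableAt ℝ (sepShellL (H₁f s) Y₁ x₀) x := fun s hs x =>
    ((contDiff_top_sepShellL (hh₁ s hs) (hHh₁ s hs) hY₁ x₀).differentiable (by simp)) x
  have hdiff₂ : ∀ s ∈ S, ∀ x : E3, DifferentiableAt ℝ (sepShellL (H₂f s) Y₂ x₀) x := fun s hs x =>
    ((contDiff_top_sepShellL (hh₂ s hs) (hHh₂ s hs) hY₂ x₀).differentiable (by simp)) x
  have hω₁ : ∀ s ∈ S, curl (sepShellL (H₁f s) Y₁ x₀) = fun x : E3 => -(c₁ s (‖x - x₀‖ ^ 2) • W₁ (x - x₀)) := by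
    intro s hs
    rw [sepShellL_eq_comp_sub (hHh₁ s hs) Y₁ x₀, curl_comp_sub_const_fun, hcurl₁ s hs]
  have hω₂ : ∀ s ∈ S, curl (sepShellL (H₂f s) Y₂ x₀) = fun x : E3 => -(c₂ s (‖x - x₀‖ ^ 2) • W₂ (x - x₀)) := by
    intro s hs
    rw [sepShellL_eq_comp_sub (hHh₂ s hs) Y₂ x₀, curl_comp_sub_const_fun, hcurl₂ s hs]
  have hωfun : ∀ s ∈ S, curl (u s) = fun x : E3 =>
      -(c₁ s (‖x - x₀‖ ^ 2) • W₁ (x - x₀)) + -(c₂ s (‖x - x₀‖ ^ 2) • W₂ (x - x₀)) := by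
    intro s hs
    funext x
    have hu : u s = fun z => sepShellL (H₁f s) Y₁ x₀ z + sepShellL (H₂f s) Y₂ x₀ z := by
      rw [hshape s hs]; rfl
    rw [hu, curl_add (hdiff₁ s hs x) (hdiff₂ s hs x), hω₁ s hs, hω₂ s hs]
  have hω : ∀ s ∈ S, ∀ y : E3, curl (u s) (x₀ + y) = -(c₁ s (‖y‖ ^ 2) • W₁ y) + -(c₂ s (‖y‖ ^ 2) • W₂ y) := by
    intro s hs y
    rw [hωfun s hs]
    simp only [add_sub_cancel_left]
  -- `Δω` at time `t` is toroidal over the pair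
  have hY₁d : Differentiable ℝ Y₁ := hY₁.contDiff.differentiable (by simp)
  have hY₂d : Differentiable ℝ Y₂ := hY₂.contDiff.differentiable (by simp)
  have hct₁ : ContDiff ℝ (⊤ : ℕ∞) (fun σ => -c₁ t σ) := (hcc₁ t ht).neg
  have hct₂ : ContDiff ℝ (⊤ : ℕ∞) (fun σ => -c₂ t σ) := (hcc₂ t ht).neg
  have hV₁ : ContDiff ℝ (⊤ : ℕ∞) (fun z : E3 => ((fun σ => -c₁ t σ) (‖z‖ ^ 2) * Y₁ z) • z) := contDiff_shell hct₁ hY₁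
  have hV₂ : ContDiff ℝ (⊤ : ℕ∞) (fun z : E3 => ((fun σ => -c₂ t σ) (‖z‖ ^ 2) * Y₂ z) • z) := contDiff_shell hct₂ hY₂
  have hT₁ : (fun z : E3 => -(c₁ t (‖z‖ ^ 2) • W₁ z)) = curl (fun z : E3 => ((fun σ => -c₁ t σ) (‖z‖ ^ 2) * Y₁ z) • z) := by
    rw [curl_shell_eq (h := fun σ => -c₁ t σ) (hct₁.differentiable (by simp)) hY₁d]
    funext z
    rw [neg_smul]
  have hT₂ : (fun z : E3 => -(c₂ t (‖z‖ ^ 2) • W₂ z)) = curl (fun z : E3 => ((fun σ => -c₂ t σ) (‖z‖ ^ 2) * Y₂ z) • z) := by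
    rw [curl_shell_eq (h := fun σ => -c₂ t σ) (hct₂.differentiable (by simp)) hY₂d]
    funext z
    rw [neg_smul]
  obtain ⟨d₁, -, hcurld₁⟩ := exists_curl_curl_curl_shell (h := fun σ => -c₁ t σ) hct₁ hY₁
  obtain ⟨d₂, -, hcurld₂⟩ := exists_curl_curl_curl_shell (h := fun σ => -c₂ t σ) hct₂ hY₂
  have hΔ : ∀ y : E3, (Δ (curl (u t))) (x₀ + y) = d₁ (‖y‖ ^ 2) • W₁ y + d₂ (‖y‖ ^ 2) • W₂ y := by
    intro y
    -- `curl (u t)` is the translate of `V = curl shell₁ + curl shell₂`, smooth and divergence free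
    set V₁ : E3 → E3 := curl (fun z : E3 => ((fun σ => -c₁ t σ) (‖z‖ ^ 2) * Y₁ z) • z) with hV₁_def
    set V₂ : E3 → E3 := curl (fun z : E3 => ((fun σ => -c₂ t σ) (‖z‖ ^ 2) * Y₂ z) • z) with hV₂_def
    have hV₁s : ContDiff ℝ (⊤ : ℕ∞) V₁ := contDiff_curl (n := ⊤) (by simpa using hV₁)
    have hV₂s : ContDiff ℝ (⊤ : ℕ∞) V₂ := contDiff_curl (n := ⊤) (by simpa using hV₂)
    have hV₁c : ContDiff ℝ (⊤ : ℕ∞) (curl V₁) := contDiff_curl (n := ⊤) (by simpa using hV₁s)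
    have hV₂c : ContDiff ℝ (⊤ : ℕ∞) (curl V₂) := contDiff_curl (n := ⊤) (by simpa using hV₂s)
    have hVs : ContDiff ℝ (⊤ : ℕ∞) (fun z => V₁ z + V₂ z) := hV₁s.add hV₂s
    have hV2 : ContDiff ℝ 2 (fun z => V₁ z + V₂ z) := hVs.of_le (by norm_cast)
    have hdivV : VectorCalculus.IsDivFree (fun z => V₁ z + V₂ z) := by
      intro z
      have h1 := divergence_curl_eq_zero_holds _ (hV₁.of_le (by norm_cast)) z
      have h2 := divergence_curl_eq_zero_holds _ (hV₂.of_le (by norm_cast)) z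
      unfold VectorCalculus.divergence at h1 h2 ⊢
      rw [fderiv_fun_add ((hV₁s.differentiable (by simp)) z) ((hV₂s.differentiable (by simp)) z)]
      push_cast
      rw [map_add, h1, h2, add_zero]
    obtain ⟨V, hV⟩ : ∃ V : E3 → E3, V = fun z => V₁ z + V₂ z := ⟨_, rfl⟩
    have hωt : curl (u t) = fun x : E3 => V (x - x₀) := by
      rw [hωfun t ht, hV]
      funext x
      simp only [← hT₁, ← hT₂]
    rw [hωt, laplacian_comp_sub_const, hV]
    have h1 := curl_curl_eq_neg_laplacian hV2 hdivV (x₀ + y - x₀)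
    -- `curl curl (V₁ + V₂) = curl curl V₁ + curl curl V₂ = −d₁ W₁ − d₂ W₂`
    have hcc : curl (curl (fun z => V₁ z + V₂ z)) (x₀ + y - x₀) = -(d₁ (‖y‖ ^ 2) • W₁ y) + -(d₂ (‖y‖ ^ 2) • W₂ y) := by
      have e1 : curl (fun z => V₁ z + V₂ z) = fun z => curl V₁ z + curl V₂ z := by
        funext z
        exact curl_add ((hV₁s.differentiable (by simp)) z) ((hV₂s.differentiable (by simp)) z)
      rw [e1, curl_add ((hV₁c.differentiable (by simp)) _) ((hV₂c.differentiable (by simp)) _), hV₁_def, hV₂_def,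
        hcurld₁, hcurld₂]
      simp only [add_sub_cancel_left, hW₁, hW₂]
    rw [hcc] at h1
    simp only [add_sub_cancel_left] at h1 ⊢
    rw [← neg_add] at h1
    exact (neg_inj.1 h1).symm
  -- `∂ₜω` at time `t` is toroidal over the pair WITH RADIAL COEFFICIENTS (parity read-off)
  have hDt : ∀ y : E3, deriv (fun s => curl (u s) (x₀ + y)) t =
      -(deriv (fun s => c₁ s (‖y‖ ^ 2)) t • W₁ y) + -(deriv (fun s => c₂ s (‖y‖ ^ 2)) t • W₂ y) := by
    intro y
    -- `F(s) = ω(s, x₀ + y)`, `G(s) = ω(s, x₀ − y)`; `(F − G)/2 = −c₁ W₁`, `(F + G)/2 = −c₂ W₂` near `t`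
    have hF : DifferentiableAt ℝ (fun s => curl (u s) (x₀ + y)) t :=
      window_differentiable_time_curl hS hcont hdiv hmild hbdd ht (x₀ + y)
    have hG : DifferentiableAt ℝ (fun s => curl (u s) (x₀ + -y)) t :=
      window_differentiable_time_curl hS hcont hdiv hmild hbdd ht (x₀ + -y)
    have hodd : (fun s => (-c₁ s (‖y‖ ^ 2)) • W₁ y) =ᶠ[𝓝 t]
        fun s => (2 : ℝ)⁻¹ • (curl (u s) (x₀ + y) - curl (u s) (x₀ + -y)) := by
      filter_upwards [hS.mem_nhds ht] with s hs
      rw [hω s hs y, hω s hs (-y), norm_neg, hW₁neg, hW₂neg]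
      module
    have heven : (fun s => (-c₂ s (‖y‖ ^ 2)) • W₂ y) =ᶠ[𝓝 t]
        fun s => (2 : ℝ)⁻¹ • (curl (u s) (x₀ + y) + curl (u s) (x₀ + -y)) := by
      filter_upwards [hS.mem_nhds ht] with s hs
      rw [hω s hs y, hω s hs (-y), norm_neg, hW₁neg, hW₂neg]
      module
    have hodd_d : DifferentiableAt ℝ (fun s => (-c₁ s (‖y‖ ^ 2)) • W₁ y) t :=
      ((hF.sub hG).const_smul (2 : ℝ)⁻¹).congr_of_eventuallyEq hodd
    have heven_d : DifferentiableAt ℝ (fun s => (-c₂ s (‖y‖ ^ 2)) • W₂ y) t :=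
      ((hF.add hG).const_smul (2 : ℝ)⁻¹).congr_of_eventuallyEq heven
    -- the scalar coefficients are differentiable wherever their carrier is nonzero
    have hscal : ∀ (c : ℝ → ℝ → ℝ) (W : E3), DifferentiableAt ℝ (fun s => (-c s (‖y‖ ^ 2)) • W) t →
        deriv (fun s => (-c s (‖y‖ ^ 2)) • W) t = -(deriv (fun s => c s (‖y‖ ^ 2)) t • W) := by
      intro c W hd
      by_cases hW0 : W = 0
      · simp [hW0]
      · have hWn : ‖W‖ ≠ 0 := norm_ne_zero_iff.2 hW0
        have hg : DifferentiableAt ℝ (fun s => -c s (‖y‖ ^ 2)) t := by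
          have h1 : DifferentiableAt ℝ (fun s => (‖W‖ ^ 2)⁻¹ * ⟪(-c s (‖y‖ ^ 2)) • W, W⟫) t :=
            (hd.inner ℝ (differentiableAt_const W)).const_mul _
          have h2 : (fun s => (‖W‖ ^ 2)⁻¹ * ⟪(-c s (‖y‖ ^ 2)) • W, W⟫) = fun s => -c s (‖y‖ ^ 2) := by
            funext s
            rw [real_inner_smul_left, real_inner_self_eq_norm_sq]
            field_simp
          rw [h2] at h1
          exact h1
        have hg' : DifferentiableAt ℝ (fun s => c s (‖y‖ ^ 2)) t := by simpa using hg.neg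
        rw [deriv_smul_const hg]
        simp only [deriv.fun_neg', neg_smul]
    -- `F = (−c₁ W₁) + (−c₂ W₂)` near `t`
    have hsplit : (fun s => curl (u s) (x₀ + y)) =ᶠ[𝓝 t]
        fun s => (-c₁ s (‖y‖ ^ 2)) • W₁ y + (-c₂ s (‖y‖ ^ 2)) • W₂ y := by
      filter_upwards [hS.mem_nhds ht] with s hs
      rw [hω s hs y, neg_smul, neg_smul]
    rw [hsplit.deriv_eq, deriv_fun_add hodd_d heven_d, hscal c₁ (W₁ y) hodd_d, hscal c₂ (W₂ y) heven_d]
  -- assemble through the vorticity equation of the window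
  refine ⟨fun r => d₁ (r ^ 2) + deriv (fun s => c₁ s (r ^ 2)) t, fun r => d₂ (r ^ 2) + deriv (fun s => c₂ s (r ^ 2)) t,
    fun y => ?_⟩
  have hvort := window_lambCurl_eq hS hcont hdiv hmild hbdd ht (x₀ + y)
  rw [hΔ y, hDt y] at hvort
  rw [add_smul, add_smul]
  have := eq_sub_of_add_eq' hvort
  rw [this]
  module

end Summit.NavierStokesRegularity.NavierStokesRegularity.Theorems.UnthreadedRigidity.MixedPair

end
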